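import Mathlib
import HarnessLib

/-!
# Route LevelSetModeration — dyadic vocabulary for the stopping-time estimate of the level-set pressure pairing
# (crux stmt-NavierStokesRegularity-18149 `HighSpeedPressureWork`)

Definitions only (plus their defining `simp`/measurability/volume lemmas). The early bookkeeping
of the crux at exponent `1/2` (registered stub `stub_earlyBookkeeping`) is attacked by a
Calderón–Zygmund stopping-time argument on one time slice: the super-level set `A = {c < |u|}`
is covered by the maximal dyadic cubes `Q` with `|A ∩ Q| ≥ θ|Q|`, the pressure is replaced by a
constant on each such cube, and the flux of the truncated field through the interfaces of
adjacent cubes is summed by parts over the finest dyadic cells. The recurring objects of that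
argument are named here so that the support files (`…Dyadic`, `…Stopping`, `…CellFlux`, …) and
the final slice estimate speak the same language:

* `LevelSetModerationDyadic.cube a S k z` — the half-open coordinate cube of the dyadic grid of
  origin `a : ι → ℝ`, base side `S` and level `k : ℕ` with integer label `z : ι → ℤ`:
  `∏ᵢ [aᵢ + (S/2ᵏ) zᵢ, aᵢ + (S/2ᵏ) zᵢ + S/2ᵏ)`;
* `LevelSetModerationDyadic.index a S k x` — the label of the level-`k` cube containing `x`,
  `⌊(xᵢ - aᵢ)/(S/2ᵏ)⌋`;
* `LevelSetModerationDyadic.IsGood A θ a S k z` — the density test `θ |Q| ≤ |A ∩ Q|` for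
  `Q = cube a S k z`;
* `LevelSetModerationDyadic.IsStopping A θ a S k z` — `Q` is good and none of its dyadic
  ancestors `cube a S j (z / 2^{k-j})`, `j < k`, is (the maximal good cubes).

Design: plain `def`s over Mathlib notions only (`Set.pi`, `Set.Ico`, `Int.floor`, `volume`), any
finite index type `ι` (the argument is run on `Fin 3 → ℝ` and, for faces, on `Fin 2 → ℝ`).
Nothing here restates a tree notion (`lean search 'dyadic'`, `'stopping'`, `'IsGood'` 2026-08-17:
only `FunctionSpaces.dyadicCutoff` (a Littlewood–Paley bump) and Mathlib's
`BoxIntegral.unitPartition.box` (mesh `1/n`, closed-open the other way, no levels); neither is a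
dyadic filtration with a density stopping rule).
-/

noncomputable section

open Set MeasureTheory

set_option linter.dupNamespace false

namespace Summit.NavierStokesRegularity.NavierStokesRegularity.Theorems.LevelSetModerationDyadic

variable {ι : Type*}

/-- **Dyadic cube** of origin `a`, base side `S`, level `k` and label `z`: the half-open box
`∏ᵢ [aᵢ + (S/2ᵏ) zᵢ, aᵢ + (S/2ᵏ) zᵢ + S/2ᵏ)` in `ι → ℝ`. [folklore] -/
def cube (a : ι → ℝ) (S : ℝ) (k : ℕ) (z : ι → ℤ) : Set (ι → ℝ) :=
  Set.pi univ fun i => Ico (a i + S / 2 ^ k * z i) (a i + S / 2 ^ k * z i + S / 2 ^ k)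

/-- **Dyadic label** of a point at level `k`: `⌊(xᵢ - aᵢ)/(S/2ᵏ)⌋`. [folklore] -/
def index (a : ι → ℝ) (S : ℝ) (k : ℕ) (x : ι → ℝ) : ι → ℤ :=
  fun i => ⌊(x i - a i) / (S / 2 ^ k)⌋

/-- **Density test** of a measurable set `A` on a dyadic cube: `θ |Q| ≤ |A ∩ Q|`. [folklore] -/
def IsGood [Fintype ι] (A : Set (ι → ℝ)) (θ : ENNReal) (a : ι → ℝ) (S : ℝ) (k : ℕ) (z : ι → ℤ) : Prop :=
  θ * volume (cube a S k z) ≤ volume (A ∩ cube a S k z)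

/-- **Stopping cubes** (maximal good cubes): `Q = cube a S k z` passes the density test and no
dyadic ancestor `cube a S j (z / 2^{k-j})`, `j < k`, does. [folklore] -/
def IsStopping [Fintype ι] (A : Set (ι → ℝ)) (θ : ENNReal) (a : ι → ℝ) (S : ℝ) (k : ℕ) (z : ι → ℤ) :
    Prop :=
  IsGood A θ a S k z ∧ ∀ j < k, ¬ IsGood A θ a S j (fun i => z i / 2 ^ (k - j))

/-! ### Defining lemmas -/

/-- Membership in a dyadic cube, coordinatewise. [folklore] -/
theorem mem_cube_iff {a : ι → ℝ} {S : ℝ} {k : ℕ} {z : ι → ℤ} {x : ι → ℝ} :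
    x ∈ cube a S k z ↔ ∀ i, a i + S / 2 ^ k * z i ≤ x i ∧ x i < a i + S / 2 ^ k * z i + S / 2 ^ k := by
  simp only [cube, mem_univ_pi, mem_Ico]

/-- The `i`-th dyadic label of a point. [folklore] -/
theorem index_apply (a : ι → ℝ) (S : ℝ) (k : ℕ) (x : ι → ℝ) (i : ι) :
    index a S k x i = ⌊(x i - a i) / (S / 2 ^ k)⌋ := rfl

/-- **A point lies in the level-`k` cube of its own label, and in no other**: for `S > 0`,
`x ∈ cube a S k z ↔ z = index a S k x`. [folklore] -/
theorem mem_cube_iff_index_eq {a : ι → ℝ} {S : ℝ} (hS : 0 < S) {k : ℕ} {z : ι → ℤ} {x : ι → ℝ} :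
    x ∈ cube a S k z ↔ z = index a S k x := by
  have hs : 0 < S / 2 ^ k := by positivity
  rw [mem_cube_iff, funext_iff]
  refine forall_congr' fun i => ?_
  rw [index_apply, eq_comm, Int.floor_eq_iff, le_div_iff₀ hs, div_lt_iff₀ hs]
  constructor
  · rintro ⟨h1, h2⟩; constructor <;> nlinarith
  · rintro ⟨h1, h2⟩; constructor <;> nlinarith

/-- Every point lies in the level-`k` cube of its label. [folklore] -/
theorem mem_cube_index {a : ι → ℝ} {S : ℝ} (hS : 0 < S) (k : ℕ) (x : ι → ℝ) :
    x ∈ cube a S k (index a S k x) :=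
  (mem_cube_iff_index_eq hS).2 rfl

/-- Dyadic cubes are measurable. [folklore] -/
theorem measurableSet_cube [Fintype ι] (a : ι → ℝ) (S : ℝ) (k : ℕ) (z : ι → ℤ) :
    MeasurableSet (cube a S k z) :=
  MeasurableSet.univ_pi fun _ => measurableSet_Ico

/-- `|cube a S k z| = (S/2ᵏ)^{#ι}` for `S ≥ 0`. [folklore] -/
theorem volume_cube [Fintype ι] (a : ι → ℝ) {S : ℝ} (hS : 0 ≤ S) (k : ℕ) (z : ι → ℤ) :
    volume (cube a S k z) = ENNReal.ofReal ((S / 2 ^ k) ^ Fintype.card ι) := by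
  rw [cube, volume_pi, Measure.pi_pi]
  simp only [Real.volume_Ico, add_sub_cancel_left, Finset.prod_const, Finset.card_univ]
  rw [ENNReal.ofReal_pow (by positivity)]

/-- Unfolding of the density test. [folklore] -/
theorem isGood_iff [Fintype ι] {A : Set (ι → ℝ)} {θ : ENNReal} {a : ι → ℝ} {S : ℝ} {k : ℕ}
    {z : ι → ℤ} :
    IsGood A θ a S k z ↔ θ * volume (cube a S k z) ≤ volume (A ∩ cube a S k z) := Iff.rfl

/-- Unfolding of the stopping rule. [folklore] -/
theorem isStopping_iff [Fintype ι] {A : Set (ι → ℝ)} {θ : ENNReal} {a : ι → ℝ} {S : ℝ} {k : ℕ}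
    {z : ι → ℤ} :
    IsStopping A θ a S k z ↔
      IsGood A θ a S k z ∧ ∀ j < k, ¬ IsGood A θ a S j (fun i => z i / 2 ^ (k - j)) := Iff.rfl

end Summit.NavierStokesRegularity.NavierStokesRegularity.Theorems.LevelSetModerationDyadic

end
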